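import Summits.CriticalPhenomena.PercolationContinuityZ3.Theorems.PercNearOneGluingNoHeavyLowerTailPolarizedThreePointLB
import Mathlib.Tactic.Ring
import Mathlib.Tactic.Linarith
import HarnessLib

/-!
# Chain polarization of `T_inc = E₃(U[a|bc], U[b|ac], U[c|ab])` (the increasing dual of 3PT-LB): reduction to the chain-polarized AG⁺ form

Support file (prover prim-l12-p6 gen 18; `--supports stmt-CriticalPhenomena-4575`; companion of `…PolarizedThreePointLB`).  No definitions, no named facts,
no sorries.  `T_inc = (1+q)(qt − e₂(u)) − e₃(u) = AG⁺ + q·AG` (prove-3 / masterthm-p1, theorem by a four-copy switching certificate) with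
`U[a|bc] = {a↔b} ∪ {a↔c}` ("`a` attached"), `q = μ(a|b|c)`.  As for 3PT-LB (`…PolarizedThreePointLB`), the chain polarization splits as
`6·T_{T_inc}(μ₁,μ₂,μ₃) = 6·T_{AG⁺}(μ₁,μ₂,μ₃) + Σ_ℓ q_ℓ·P(j,k)` (`six_polar_tinc_eq`, `ring`), the second term is `≥ 0` along a chain `w₃ ≤ w₂ ≤ w₁` by the
polarized Aas–Gladkov theorem of prim-e3grp-switch-3 (`polar_qAG_nonneg`), hence MP(T_inc) ⟸ MP(AG⁺) chainwise (`polar_tinc_ge_polar_agplus`) — the measure-level form of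
switch-3's fibre reduction BCP**(AG⁺₃) ⇒ BCP**(T_inc) (memo prim-e3grp/prim-e3grp-switch-3/FINDINGS-switch3-g2.md §2d(iv)).  So for BOTH proved cubic three-point rows the chain
polarization (CONJECTURE MP, INEQ-CLAIMS l.867) reduces to the single statement MP(AG⁺).
Memo: run/shared/lean/prim/prim-l12/FROM-prim-l12-p6-g18-MPC-3PTLB-STRUCTURE.md.
-/

noncomputable section

namespace Summit.CriticalPhenomena.PercolationContinuityZ3.Theorems

namespace PolarizedThreePointLB

open MeasureTheory Literature.Probability.Percolation Literature.Probability.LatticeModels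

/-! ### The identity and the attachment cells

`U[a|bc] = {a↔b} ∪ {a↔c}` ("`a` is attached"), etc.; the three attachment events are increasing with pairwise intersections the pair connections
and triple intersection `{a↔b↔c}`.  The polarization identity has `q_ℓ = μ_ℓ(a|b|c)` in place of `t_ℓ`. -/

/-- **`6·T_{T_inc} = 6·T_{AG⁺} + Σ_ℓ q_ℓ·P(j,k)`** (`q_ℓ = 1 − x_ℓ − y_ℓ − z_ℓ + 2t_ℓ`), the polarized Sahi form of the three attachment events
`U_a = {a↔b}∪{a↔c}`, `U_b`, `U_c` (masses `x+y−t`, `x+z−t`, `y+z−t`; pairwise intersections `x, y, z`; triple `t`) in the connection masses. [this work] -/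
theorem six_polar_tinc_eq (x₁ y₁ z₁ t₁ x₂ y₂ z₂ t₂ x₃ y₃ z₃ t₃ : ℝ) :
    ((2 * t₁ + (x₁ + y₁ - t₁) * (x₂ + z₂ - t₂) * (y₃ + z₃ - t₃) - (x₁ + y₁ - t₁) * z₂ - (x₁ + z₁ - t₁) * y₂ - (y₁ + z₁ - t₁) * x₂) +
        (2 * t₁ + (x₁ + y₁ - t₁) * (x₃ + z₃ - t₃) * (y₂ + z₂ - t₂) - (x₁ + y₁ - t₁) * z₃ - (x₁ + z₁ - t₁) * y₃ - (y₁ + z₁ - t₁) * x₃) +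
        (2 * t₂ + (x₂ + y₂ - t₂) * (x₁ + z₁ - t₁) * (y₃ + z₃ - t₃) - (x₂ + y₂ - t₂) * z₁ - (x₂ + z₂ - t₂) * y₁ - (y₂ + z₂ - t₂) * x₁) +
        (2 * t₂ + (x₂ + y₂ - t₂) * (x₃ + z₃ - t₃) * (y₁ + z₁ - t₁) - (x₂ + y₂ - t₂) * z₃ - (x₂ + z₂ - t₂) * y₃ - (y₂ + z₂ - t₂) * x₃) +
        (2 * t₃ + (x₃ + y₃ - t₃) * (x₁ + z₁ - t₁) * (y₂ + z₂ - t₂) - (x₃ + y₃ - t₃) * z₁ - (x₃ + z₃ - t₃) * y₁ - (y₃ + z₃ - t₃) * x₁) +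
        (2 * t₃ + (x₃ + y₃ - t₃) * (x₂ + z₂ - t₂) * (y₁ + z₁ - t₁) - (x₃ + y₃ - t₃) * z₂ - (x₃ + z₃ - t₃) * y₂ - (y₃ + z₃ - t₃) * x₂)) =
      (((1 - x₁ - y₁ - z₁ + 2 * t₁) * t₂ + (1 - x₂ - y₂ - z₂ + 2 * t₂) * t₁ + (1 - x₁ - y₁ - z₁ + 2 * t₁) * t₃ +
              (1 - x₃ - y₃ - z₃ + 2 * t₃) * t₁ + (1 - x₂ - y₂ - z₂ + 2 * t₂) * t₃ + (1 - x₃ - y₃ - z₃ + 2 * t₃) * t₂) -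
            (((x₁ - t₁) * (y₂ - t₂) + (x₁ - t₁) * (z₂ - t₂) + (y₁ - t₁) * (z₂ - t₂)) +
              ((x₂ - t₂) * (y₁ - t₁) + (x₂ - t₂) * (z₁ - t₁) + (y₂ - t₂) * (z₁ - t₁)) +
              ((x₁ - t₁) * (y₃ - t₃) + (x₁ - t₁) * (z₃ - t₃) + (y₁ - t₁) * (z₃ - t₃)) +
              ((x₃ - t₃) * (y₁ - t₁) + (x₃ - t₃) * (z₁ - t₁) + (y₃ - t₃) * (z₁ - t₁)) +
              ((x₂ - t₂) * (y₃ - t₃) + (x₂ - t₂) * (z₃ - t₃) + (y₂ - t₂) * (z₃ - t₃)) +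
              ((x₃ - t₃) * (y₂ - t₂) + (x₃ - t₃) * (z₂ - t₂) + (y₃ - t₃) * (z₂ - t₂))) -
          ((x₁ - t₁) * (y₂ - t₂) * (z₃ - t₃) + (x₁ - t₁) * (y₃ - t₃) * (z₂ - t₂) + (x₂ - t₂) * (y₁ - t₁) * (z₃ - t₃) +
            (x₂ - t₂) * (y₃ - t₃) * (z₁ - t₁) + (x₃ - t₃) * (y₁ - t₁) * (z₂ - t₂) + (x₃ - t₃) * (y₂ - t₂) * (z₁ - t₁))) +
        ((1 - x₁ - y₁ - z₁ + 2 * t₁) *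
            ((1 - x₂ - y₂ - z₂ + 2 * t₂) * t₃ + (1 - x₃ - y₃ - z₃ + 2 * t₃) * t₂ -
              ((x₂ - t₂) * (y₃ - t₃) + (x₃ - t₃) * (y₂ - t₂) + (x₂ - t₂) * (z₃ - t₃) + (x₃ - t₃) * (z₂ - t₂) + (y₂ - t₂) * (z₃ - t₃) +
                (y₃ - t₃) * (z₂ - t₂))) +
          (1 - x₂ - y₂ - z₂ + 2 * t₂) *
            ((1 - x₁ - y₁ - z₁ + 2 * t₁) * t₃ + (1 - x₃ - y₃ - z₃ + 2 * t₃) * t₁ -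
              ((x₁ - t₁) * (y₃ - t₃) + (x₃ - t₃) * (y₁ - t₁) + (x₁ - t₁) * (z₃ - t₃) + (x₃ - t₃) * (z₁ - t₁) + (y₁ - t₁) * (z₃ - t₃) +
                (y₃ - t₃) * (z₁ - t₁))) +
          (1 - x₃ - y₃ - z₃ + 2 * t₃) *
            ((1 - x₁ - y₁ - z₁ + 2 * t₁) * t₂ + (1 - x₂ - y₂ - z₂ + 2 * t₂) * t₁ -
              ((x₁ - t₁) * (y₂ - t₂) + (x₂ - t₂) * (y₁ - t₁) + (x₁ - t₁) * (z₂ - t₂) + (x₂ - t₂) * (z₁ - t₁) + (y₁ - t₁) * (z₂ - t₂) +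
                (y₂ - t₂) * (z₁ - t₁)))) := by
  ring

section CellsU

variable {V : Type*} [Finite V]

/-- **The attachment events in the connection masses**: `μ({a↔b}∪{a↔c}) = x + y − t`, `μ({a↔b}∪{b↔c}) = x + z − t`, `μ({a↔c}∪{b↔c}) = y + z − t`, their
pairwise intersections have masses `x, y, z` and the triple intersection mass `t`. [folklore] -/
theorem cellsU_eq (w : Sym2 V → unitInterval) (a b c : V) :
    (prodBernoulli w).real (openConn a b ∪ openConn a c) =
        (prodBernoulli w).real (openConn a b) + (prodBernoulli w).real (openConn a c) - (prodBernoulli w).real (openConn a b ∩ openConn a c) ∧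
    (prodBernoulli w).real (openConn a b ∪ openConn b c) =
        (prodBernoulli w).real (openConn a b) + (prodBernoulli w).real (openConn b c) - (prodBernoulli w).real (openConn a b ∩ openConn a c) ∧
    (prodBernoulli w).real (openConn a c ∪ openConn b c) =
        (prodBernoulli w).real (openConn a c) + (prodBernoulli w).real (openConn b c) - (prodBernoulli w).real (openConn a b ∩ openConn a c) ∧
    (prodBernoulli w).real ((openConn a b ∪ openConn a c) ∩ (openConn a b ∪ openConn b c)) = (prodBernoulli w).real (openConn a b) ∧
    (prodBernoulli w).real ((openConn a b ∪ openConn a c) ∩ (openConn a c ∪ openConn b c)) = (prodBernoulli w).real (openConn a c) ∧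
    (prodBernoulli w).real ((openConn a b ∪ openConn b c) ∩ (openConn a c ∪ openConn b c)) = (prodBernoulli w).real (openConn b c) ∧
    (prodBernoulli w).real ((openConn a b ∪ openConn a c) ∩ (openConn a b ∪ openConn b c) ∩ (openConn a c ∪ openConn b c)) =
        (prodBernoulli w).real (openConn a b ∩ openConn a c) := by
  classical
  set μ := prodBernoulli w with hμ
  set Eab : Set (BondConfig V) := openConn a b with hEab
  set Eac : Set (BondConfig V) := openConn a c with hEac
  set Ebc : Set (BondConfig V) := openConn b c with hEbc
  have mEab : MeasurableSet Eab := MeasurableSet.of_discrete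
  have mEac : MeasurableSet Eac := MeasurableSet.of_discrete
  have mEbc : MeasurableSet Ebc := MeasurableSet.of_discrete
  have hT₁ : Eab ∩ Ebc = Eab ∩ Eac := openConn_inter_ab_bc a b c
  have hT₂ : Eac ∩ Ebc = Eab ∩ Eac := openConn_inter_ac_bc a b c
  -- set identities for the intersections of the attachment events
  have iab : (Eab ∪ Eac) ∩ (Eab ∪ Ebc) = Eab := by
    rw [← Set.union_inter_distrib_left, hT₂]; exact Set.union_eq_left.2 Set.inter_subset_left
  have iac : (Eab ∪ Eac) ∩ (Eac ∪ Ebc) = Eac := by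
    rw [Set.union_comm Eab Eac, ← Set.union_inter_distrib_left, hT₁]; exact Set.union_eq_left.2 Set.inter_subset_right
  have ibc : (Eab ∪ Ebc) ∩ (Eac ∪ Ebc) = Ebc := by
    rw [Set.union_comm Eab Ebc, Set.union_comm Eac Ebc, ← Set.union_inter_distrib_left]
    refine Set.union_eq_left.2 ?_
    rw [← hT₁]; exact Set.inter_subset_right
  have iabc : (Eab ∪ Eac) ∩ (Eab ∪ Ebc) ∩ (Eac ∪ Ebc) = Eab ∩ Eac := by
    rw [iab, Set.inter_union_distrib_left, hT₁, Set.union_self]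
  -- masses of the unions
  have hU₁ : μ.real (Eab ∪ Eac) = μ.real Eab + μ.real Eac - μ.real (Eab ∩ Eac) := by
    have h := measureReal_union_add_inter (μ := μ) (s := Eab) mEac; linarith
  have hU₂ : μ.real (Eab ∪ Ebc) = μ.real Eab + μ.real Ebc - μ.real (Eab ∩ Eac) := by
    have h := measureReal_union_add_inter (μ := μ) (s := Eab) mEbc; rw [hT₁] at h; linarith
  have hU₃ : μ.real (Eac ∪ Ebc) = μ.real Eac + μ.real Ebc - μ.real (Eab ∩ Eac) := by
    have h := measureReal_union_add_inter (μ := μ) (s := Eac) mEbc; rw [hT₂] at h; linarith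
  refine ⟨hU₁, hU₂, hU₃, ?_, ?_, ?_, ?_⟩
  · rw [iab]
  · rw [iac]
  · rw [ibc]
  · rw [iabc]

end CellsU

section MainInc

variable {V : Type*} [Finite V]

/-- **The `q·AG` part of the chain-polarized `T_inc` form is nonnegative**: for `w₃ ≤ w₂ ≤ w₁`, `0 ≤ Σ_ℓ q_ℓ·P(j,k)` with `q_ℓ = μ_ℓ(a|b|c)`.
[this work] -/
theorem polar_qAG_nonneg (w₁ w₂ w₃ : Sym2 V → unitInterval) (h₂₁ : ∀ e, (w₂ e : ℝ) ≤ w₁ e) (h₃₂ : ∀ e, (w₃ e : ℝ) ≤ w₂ e)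
    (a b c : V) :
    let x₁ := (prodBernoulli w₁).real (openConn a b); let y₁ := (prodBernoulli w₁).real (openConn a c)
    let z₁ := (prodBernoulli w₁).real (openConn b c); let t₁ := (prodBernoulli w₁).real (openConn a b ∩ openConn a c)
    let x₂ := (prodBernoulli w₂).real (openConn a b); let y₂ := (prodBernoulli w₂).real (openConn a c)
    let z₂ := (prodBernoulli w₂).real (openConn b c); let t₂ := (prodBernoulli w₂).real (openConn a b ∩ openConn a c)
    let x₃ := (prodBernoulli w₃).real (openConn a b); let y₃ := (prodBernoulli w₃).real (openConn a c)
    let z₃ := (prodBernoulli w₃).real (openConn b c); let t₃ := (prodBernoulli w₃).real (openConn a b ∩ openConn a c)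
    0 ≤ (1 - x₁ - y₁ - z₁ + 2 * t₁) *
            ((1 - x₂ - y₂ - z₂ + 2 * t₂) * t₃ + (1 - x₃ - y₃ - z₃ + 2 * t₃) * t₂ -
              ((x₂ - t₂) * (y₃ - t₃) + (x₃ - t₃) * (y₂ - t₂) + (x₂ - t₂) * (z₃ - t₃) + (x₃ - t₃) * (z₂ - t₂) + (y₂ - t₂) * (z₃ - t₃) +
                (y₃ - t₃) * (z₂ - t₂))) +
          (1 - x₂ - y₂ - z₂ + 2 * t₂) *
            ((1 - x₁ - y₁ - z₁ + 2 * t₁) * t₃ + (1 - x₃ - y₃ - z₃ + 2 * t₃) * t₁ -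
              ((x₁ - t₁) * (y₃ - t₃) + (x₃ - t₃) * (y₁ - t₁) + (x₁ - t₁) * (z₃ - t₃) + (x₃ - t₃) * (z₁ - t₁) + (y₁ - t₁) * (z₃ - t₃) +
                (y₃ - t₃) * (z₁ - t₁))) +
          (1 - x₃ - y₃ - z₃ + 2 * t₃) *
            ((1 - x₁ - y₁ - z₁ + 2 * t₁) * t₂ + (1 - x₂ - y₂ - z₂ + 2 * t₂) * t₁ -
              ((x₁ - t₁) * (y₂ - t₂) + (x₂ - t₂) * (y₁ - t₁) + (x₁ - t₁) * (z₂ - t₂) + (x₂ - t₂) * (z₁ - t₁) + (y₁ - t₁) * (z₂ - t₂) +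
                (y₂ - t₂) * (z₁ - t₁))) := by
  intro x₁ y₁ z₁ t₁ x₂ y₂ z₂ t₂ x₃ y₃ z₃ t₃
  have h₃₁ : ∀ e, (w₃ e : ℝ) ≤ w₁ e := fun e => (h₃₂ e).trans (h₂₁ e)
  have P23 := polarAG_nonneg w₂ w₃ h₃₂ a b c
  have P13 := polarAG_nonneg w₁ w₃ h₃₁ a b c
  have P12 := polarAG_nonneg w₁ w₂ h₂₁ a b c
  -- `q_ℓ = μ_ℓ(a|b|c) ≥ 0`, written in the connection masses
  obtain ⟨-, -, -, -, -, -, cQ₁, -, -, -⟩ := cells_eq w₁ a b c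
  obtain ⟨-, -, -, -, -, -, cQ₂, -, -, -⟩ := cells_eq w₂ a b c
  obtain ⟨-, -, -, -, -, -, cQ₃, -, -, -⟩ := cells_eq w₃ a b c
  have hQ₁ : (0 : ℝ) ≤ (prodBernoulli w₁).real ((openConn a b)ᶜ ∩ (openConn a c)ᶜ ∩ (openConn b c)ᶜ) := measureReal_nonneg
  have hQ₂ : (0 : ℝ) ≤ (prodBernoulli w₂).real ((openConn a b)ᶜ ∩ (openConn a c)ᶜ ∩ (openConn b c)ᶜ) := measureReal_nonneg
  have hQ₃ : (0 : ℝ) ≤ (prodBernoulli w₃).real ((openConn a b)ᶜ ∩ (openConn a c)ᶜ ∩ (openConn b c)ᶜ) := measureReal_nonneg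
  rw [cQ₁] at hQ₁
  rw [cQ₂] at hQ₂
  rw [cQ₃] at hQ₃
  have e1 := mul_nonneg hQ₁ P23
  have e2 := mul_nonneg hQ₂ P13
  have e3 := mul_nonneg hQ₃ P12
  linarith [e1, e2, e3]

/-- **Chain-polarized `T_inc` ≥ chain-polarized AG⁺ (unconditional)** for `w₃ ≤ w₂ ≤ w₁`: the polarized Sahi form of the three attachment events
`U_a = {a↔b}∪{a↔c}`, `U_b = {a↔b}∪{b↔c}`, `U_c = {a↔c}∪{b↔c}` is at least the polarization of `q t − e₂(u) − e₃(u)` (connection masses). [this work] -/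
theorem polar_tinc_ge_polar_agplus (w₁ w₂ w₃ : Sym2 V → unitInterval) (h₂₁ : ∀ e, (w₂ e : ℝ) ≤ w₁ e) (h₃₂ : ∀ e, (w₃ e : ℝ) ≤ w₂ e)
    (a b c : V) :
    let μ₁ := prodBernoulli w₁; let μ₂ := prodBernoulli w₂; let μ₃ := prodBernoulli w₃
    let A : Set (BondConfig V) := openConn a b ∪ openConn a c; let B : Set (BondConfig V) := openConn a b ∪ openConn b c
    let C : Set (BondConfig V) := openConn a c ∪ openConn b c
    let x₁ := μ₁.real (openConn a b); let y₁ := μ₁.real (openConn a c); let z₁ := μ₁.real (openConn b c); let t₁ := μ₁.real (openConn a b ∩ openConn a c)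
    let x₂ := μ₂.real (openConn a b); let y₂ := μ₂.real (openConn a c); let z₂ := μ₂.real (openConn b c); let t₂ := μ₂.real (openConn a b ∩ openConn a c)
    let x₃ := μ₃.real (openConn a b); let y₃ := μ₃.real (openConn a c); let z₃ := μ₃.real (openConn b c); let t₃ := μ₃.real (openConn a b ∩ openConn a c)
    (((1 - x₁ - y₁ - z₁ + 2 * t₁) * t₂ + (1 - x₂ - y₂ - z₂ + 2 * t₂) * t₁ + (1 - x₁ - y₁ - z₁ + 2 * t₁) * t₃ +
              (1 - x₃ - y₃ - z₃ + 2 * t₃) * t₁ + (1 - x₂ - y₂ - z₂ + 2 * t₂) * t₃ + (1 - x₃ - y₃ - z₃ + 2 * t₃) * t₂) -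
            (((x₁ - t₁) * (y₂ - t₂) + (x₁ - t₁) * (z₂ - t₂) + (y₁ - t₁) * (z₂ - t₂)) +
              ((x₂ - t₂) * (y₁ - t₁) + (x₂ - t₂) * (z₁ - t₁) + (y₂ - t₂) * (z₁ - t₁)) +
              ((x₁ - t₁) * (y₃ - t₃) + (x₁ - t₁) * (z₃ - t₃) + (y₁ - t₁) * (z₃ - t₃)) +
              ((x₃ - t₃) * (y₁ - t₁) + (x₃ - t₃) * (z₁ - t₁) + (y₃ - t₃) * (z₁ - t₁)) +
              ((x₂ - t₂) * (y₃ - t₃) + (x₂ - t₂) * (z₃ - t₃) + (y₂ - t₂) * (z₃ - t₃)) +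
              ((x₃ - t₃) * (y₂ - t₂) + (x₃ - t₃) * (z₂ - t₂) + (y₃ - t₃) * (z₂ - t₂))) -
          ((x₁ - t₁) * (y₂ - t₂) * (z₃ - t₃) + (x₁ - t₁) * (y₃ - t₃) * (z₂ - t₂) + (x₂ - t₂) * (y₁ - t₁) * (z₃ - t₃) +
            (x₂ - t₂) * (y₃ - t₃) * (z₁ - t₁) + (x₃ - t₃) * (y₁ - t₁) * (z₂ - t₂) + (x₃ - t₃) * (y₂ - t₂) * (z₁ - t₁))) ≤
      (2 * μ₁.real (A ∩ B ∩ C) + μ₁.real A * μ₂.real B * μ₃.real C - μ₁.real A * μ₂.real (B ∩ C) - μ₁.real B * μ₂.real (A ∩ C) - μ₁.real C * μ₂.real (A ∩ B)) +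
        (2 * μ₁.real (A ∩ B ∩ C) + μ₁.real A * μ₃.real B * μ₂.real C - μ₁.real A * μ₃.real (B ∩ C) - μ₁.real B * μ₃.real (A ∩ C) - μ₁.real C * μ₃.real (A ∩ B)) +
        (2 * μ₂.real (A ∩ B ∩ C) + μ₂.real A * μ₁.real B * μ₃.real C - μ₂.real A * μ₁.real (B ∩ C) - μ₂.real B * μ₁.real (A ∩ C) - μ₂.real C * μ₁.real (A ∩ B)) +
        (2 * μ₂.real (A ∩ B ∩ C) + μ₂.real A * μ₃.real B * μ₁.real C - μ₂.real A * μ₃.real (B ∩ C) - μ₂.real B * μ₃.real (A ∩ C) - μ₂.real C * μ₃.real (A ∩ B)) +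
        (2 * μ₃.real (A ∩ B ∩ C) + μ₃.real A * μ₁.real B * μ₂.real C - μ₃.real A * μ₁.real (B ∩ C) - μ₃.real B * μ₁.real (A ∩ C) - μ₃.real C * μ₁.real (A ∩ B)) +
        (2 * μ₃.real (A ∩ B ∩ C) + μ₃.real A * μ₂.real B * μ₁.real C - μ₃.real A * μ₂.real (B ∩ C) - μ₃.real B * μ₂.real (A ∩ C) - μ₃.real C * μ₂.real (A ∩ B)) := by
  intro μ₁ μ₂ μ₃ A B C x₁ y₁ z₁ t₁ x₂ y₂ z₂ t₂ x₃ y₃ z₃ t₃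
  have hT := polar_qAG_nonneg w₁ w₂ w₃ h₂₁ h₃₂ a b c
  obtain ⟨ua₁, ub₁, uc₁, iab₁, iac₁, ibc₁, iabc₁⟩ := cellsU_eq w₁ a b c
  obtain ⟨ua₂, ub₂, uc₂, iab₂, iac₂, ibc₂, iabc₂⟩ := cellsU_eq w₂ a b c
  obtain ⟨ua₃, ub₃, uc₃, iab₃, iac₃, ibc₃, iabc₃⟩ := cellsU_eq w₃ a b c
  have hid := six_polar_tinc_eq x₁ y₁ z₁ t₁ x₂ y₂ z₂ t₂ x₃ y₃ z₃ t₃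
  simp only [μ₁, μ₂, μ₃, A, B, C, x₁, y₁, z₁, t₁, x₂, y₂, z₂, t₂, x₃, y₃, z₃, t₃] at hT hid ua₁ ub₁ uc₁ iab₁ iac₁ ibc₁ iabc₁ ua₂ ub₂ uc₂ iab₂ iac₂ ibc₂ iabc₂ ua₃ ub₃ uc₃ iab₃ iac₃ ibc₃ iabc₃ ⊢
  rw [ua₁, ub₁, uc₁, iab₁, iac₁, ibc₁, iabc₁, ua₂, ub₂, uc₂, iab₂, iac₂, ibc₂, iabc₂, ua₃, ub₃, uc₃, iab₃, iac₃, ibc₃, iabc₃]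
  linarith [hid, hT]

end MainInc

end PolarizedThreePointLB

end Summit.CriticalPhenomena.PercolationContinuityZ3.Theorems

end
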